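import Summits.AtomisticToContinuum.BoseEinsteinCondensation.Theorems.BECCellInformationOneBodyEntropyBoundInsertionAssembly
import Summits.AtomisticToContinuum.BoseEinsteinCondensation.Theorems.BECCellInformationOneBodyEntropyBoundFirstVariation
import Summits.AtomisticToContinuum.BoseEinsteinCondensation.Theorems.BECCellInformationOneBodyEntropyBoundProductJastrow
import Summits.AtomisticToContinuum.BoseEinsteinCondensation.Theorems.BECCellInformationOneBodyEntropyBoundJastrowProfile
import Summits.AtomisticToContinuum.BoseEinsteinCondensation.Theorems.BECCellInformationOneBodyEntropyBoundDirichletFloor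
import Literature.MathematicalPhysics.QuantumManyBody.BoseGasFlatTopProfile
import Literature.MathematicalPhysics.QuantumManyBody.BoseGasProductOrbital
import Literature.MathematicalPhysics.QuantumManyBody.BoseGasInsertionScaling
import HarnessLib

/-!
# Crux `RigidMomentumBound` (stmt-AtomisticToContinuum-13034), line `registered`:
# stub `stub_insertionBound` (F3)

Route `BECTangentRigidity`, problem `BoseEinsteinCondensation` of the summit
`AtomisticToContinuum`; support file for the line's skeleton (namespace
`…Theorems.RigidMomentumBound`).

**Statement** (`stub_insertionBound`, an `N`-INDEPENDENT bound on the canonical chemical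
potential `μ_N = E₀(N+1, L) - E₀(N, L)` at low density, for EVERY measurable finite-range
`v ≥ 0`, hard cores and hollow potentials included): if `v(r) = 0` for `r > R₀ > 0`, `L > 0` and
`N R₀³ ≤ L³/2000`, then `E₀(N+1, L) ≤ E₀(N, L) + 120/L² + 13000·N·R₀/L³`. (Registered as an
implication from the first-variation brick F1 of the line; that hypothesis is not used — the
tree's first variation `stub_firstVariation` of the crux `OneBodyEntropyBound` serves instead.)

**Proof.** *Scale.* By the exact dilation covariance `E₀(s⁻²v(·/s), N, sL) = s⁻²E₀(v, N, L)`
both sides scale like `s⁻²` (`InsertionScaling.insertionBound_of_fixedRange`), so it suffices to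
treat the range `R₀ = 2` (`insertionBound_range_two`). *Trial state.* For a near-minimiser `Φ`
of `E₀(n, L)` insert the particle `x = X 0` in the flat-top orbital `Θ` of the box
(`FlatTop.exists_flatTopProfile` + `ProductOrbital.exists_productOrbital`:
`𝓔₀[Θ] ≤ 48π²/(11L²)`, `|Θ|² ≤ (16/11)³/L³`), dressed with the product Jastrow factor
`F(X) = ∏ⱼ f(x - xⱼ)` of the exponential profile `f(z) = 1 - (1 + (‖z‖-2)₊)e^{-(‖z‖-2)₊}`
(`stub_productJastrow`: `C¹`, `0 ≤ F ≤ 1`, `|∇₀F| ≤ 1 - F`, `|∇ⱼF| ≤ 1 - f(x-xⱼ)`,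
`1 - F ≤ Σⱼ(1 - f(x-xⱼ))`); since `f = 0` on the ball of radius `2 ⊇` range of `v`, the new
particle does not interact at all (`⊤·0 = 0`). *Energy.* `InsertionAssembly.dressed_insertion_at`
(Dirichlet bosonic floor for `ΘFΦ`, pointwise calculus of the dressed product, first variation
at every frozen `x` with error `≤ 1/L²`) gives `E₀(n+1)M ≤ E₀(n)M + 2𝓔₀[Θ] + 1/L² + 9w`,
`1 ≤ M + 2w`, `M ≤ 1`, with Jastrow weight `w ≤ sup|Θ|²·n·∫(1-f) ≤ (16/11)³(n/L³)·4π·92/3`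
(`InsertionAssembly.lintegral_W₁`, `InsertionScaling.lintegral_deficiency_le`). *Constants.*
Cancelling the mass (`InsertionScaling.final_bound_real`) and `8n ≤ L³/2000` give the registered
constants (`numeric_bound`; the proof's true values are `≈ 103/L²` and `≈ 6270·n·R₀/L³`).
-/

noncomputable section

namespace Summit.AtomisticToContinuum.BoseEinsteinCondensation.Theorems.RigidMomentumBound

open MeasureTheory Filter Set
open scoped ENNReal NNReal BigOperators
open Literature.MathematicalPhysics.QuantumManyBody.BoseGas
open Summit.AtomisticToContinuum.BoseEinsteinCondensation.Cruxes.OneBodyEntropyBound.Birth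

namespace InsertionBound

/-! ### The explicit Jastrow profile with core radius `2` -/

/-- The exponential Jastrow profile `f(z) = 1 - (1 + (‖z‖-2)₊) e^{-(‖z‖-2)₊}` of
`…JastrowProfile` with core radius `2`: `C¹`, values in `[0,1]`, `f = 0` on the closed ball of
radius `2`, `‖Df‖ ≤ 1 - f`. [folklore] -/
theorem prof_props :
    ContDiff ℝ 1 (fun z : Space => 1 - (1 + max (‖z‖ - 2) 0) * Real.exp (-max (‖z‖ - 2) 0)) ∧
    (∀ z : Space, 0 ≤ 1 - (1 + max (‖z‖ - 2) 0) * Real.exp (-max (‖z‖ - 2) 0) ∧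
      1 - (1 + max (‖z‖ - 2) 0) * Real.exp (-max (‖z‖ - 2) 0) ≤ 1) ∧
    (∀ z : Space, ‖z‖ ≤ 2 → 1 - (1 + max (‖z‖ - 2) 0) * Real.exp (-max (‖z‖ - 2) 0) = 0) ∧
    (∀ z : Space, ‖fderiv ℝ (fun z : Space => 1 - (1 + max (‖z‖ - 2) 0) *
      Real.exp (-max (‖z‖ - 2) 0)) z‖ ≤
        1 - (1 - (1 + max (‖z‖ - 2) 0) * Real.exp (-max (‖z‖ - 2) 0))) := by
  refine ⟨JastrowProfile.contDiff_radial two_pos, fun z => ?_,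
    fun z hz => JastrowProfile.radial_eq_zero hz, fun z => ?_⟩
  · have h := JastrowProfile.profile_pos_le_one (le_max_right (‖z‖ - 2) 0)
    exact ⟨sub_nonneg.2 h.2, sub_le_self _ h.1.le⟩
  · refine (JastrowProfile.norm_fderiv_radial_le two_pos z).trans ?_
    rw [sub_sub_cancel]
    exact mul_le_mul_of_nonneg_right (by linarith [le_max_right (‖z‖ - 2) 0])
      (Real.exp_pos _).le

/-- **The Jastrow volume**: `∫ (1 - f) ≤ 4π(8/3 + 8 + 12 + 8) = 4π · 92/3` for the profile with
core radius `2` (`InsertionScaling.lintegral_deficiency_le`). [folklore] -/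
theorem lintegral_one_sub_prof_le :
    ∫⁻ z : Space, ENNReal.ofReal
        (1 - (1 - (1 + max (‖z‖ - 2) 0) * Real.exp (-max (‖z‖ - 2) 0))) ≤
      ENNReal.ofReal (4 * Real.pi * (92 / 3)) := by
  simp_rw [sub_sub_cancel]
  refine (InsertionScaling.lintegral_deficiency_le (R := 2) (by norm_num)).trans (le_of_eq ?_)
  norm_num

/-- **The dressed particle does not interact**: `v = 0` beyond `R` and `f = 0` on the closed
ball of radius `R` give, for every bath particle, `v(|x - Z j|) = 0` or the product factor
vanishes. [folklore] -/
theorem cross_or_factor_eq_zero {n : ℕ} {v : ℝ → ℝ≥0∞} {R : ℝ} (hv : ∀ r, R < r → v r = 0)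
    {f : Space → ℝ} (hfR : ∀ z : Space, ‖z‖ ≤ R → f z = 0) (x : Space) (Z : Config n)
    (j : Fin n) :
    v (dist x (Z j)) = 0 ∨ (fun X : Config (n + 1) => ∏ j : Fin n, f (X 0 - X j.succ))
      (Matrix.vecCons x Z) = 0 := by
  by_cases h : f (x - Z j) = 0
  · right
    simp only [Matrix.cons_val_zero, Matrix.cons_val_succ]
    exact Finset.prod_eq_zero (Finset.mem_univ j) h
  · left
    refine hv _ ?_
    rw [dist_eq_norm]
    by_contra hle
    exact h (hfR _ (not_lt.1 hle))

/-- **The numerical bookkeeping** (`π < 3.15`): with the kinetic constant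
`c' = (2 · 48π²/11 + 1)/L²` and the Jastrow mass defect `w' = (16/11)³ · (n/L³) · 4π(92/3)` at
density `8n ≤ L³/2000`, `(c' + 9w')/(1 - 2w') ≤ 120/L² + 13000 · n · 2/L³`. [folklore] -/
theorem numeric_bound {L : ℝ} {n : ℕ} (hL : 0 < L) (hn : (n : ℝ) * 2 ^ 3 ≤ L ^ 3 / 2000) :
    (2 * (3 * Real.pi ^ 2 / (11 / 16) / L ^ 2) + 1 / L ^ 2 +
        9 * ((11 / 16 : ℝ)⁻¹ ^ 3 / L ^ 3 * (n * (4 * Real.pi * (92 / 3))))) /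
      (1 - 2 * ((11 / 16 : ℝ)⁻¹ ^ 3 / L ^ 3 * (n * (4 * Real.pi * (92 / 3))))) ≤
      120 / L ^ 2 + 13000 * n * 2 / L ^ 3 := by
  have hπ := Real.pi_lt_d2
  have hπ0 := Real.pi_pos
  set a : ℝ := 1 / L ^ 2 with ha
  set y : ℝ := (n : ℝ) / L ^ 3 with hy
  have ha0 : 0 < a := by positivity
  have hy0 : 0 ≤ y := by positivity
  have hL3 : 0 < L ^ 3 := by positivity
  have hy1 : y ≤ 1 / 16000 := by
    rw [hy, div_le_iff₀ hL3]; linarith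
  -- the constants
  have hK : (11 / 16 : ℝ)⁻¹ ^ 3 * (4 * Real.pi * (92 / 3)) ≤ 1190 := by nlinarith
  have hK0 : 0 ≤ (11 / 16 : ℝ)⁻¹ ^ 3 * (4 * Real.pi * (92 / 3)) := by positivity
  have hc : 2 * (3 * Real.pi ^ 2 / (11 / 16)) + 1 ≤ 88 := by nlinarith
  -- everything in terms of `a` and `y`
  have e1 : 2 * (3 * Real.pi ^ 2 / (11 / 16) / L ^ 2) + 1 / L ^ 2 =
      (2 * (3 * Real.pi ^ 2 / (11 / 16)) + 1) * a := by rw [ha]; ring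
  have e2 : (11 / 16 : ℝ)⁻¹ ^ 3 / L ^ 3 * (n * (4 * Real.pi * (92 / 3))) =
      ((11 / 16 : ℝ)⁻¹ ^ 3 * (4 * Real.pi * (92 / 3))) * y := by rw [hy]; ring
  have e3 : (120 : ℝ) / L ^ 2 + 13000 * n * 2 / L ^ 3 = 120 * a + 26000 * y := by
    rw [ha, hy]; ring
  rw [e1, e2, e3]
  set K : ℝ := (11 / 16 : ℝ)⁻¹ ^ 3 * (4 * Real.pi * (92 / 3)) with hKdef
  set c₀ : ℝ := 2 * (3 * Real.pi ^ 2 / (11 / 16)) + 1 with hc₀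
  have hKy : K * y ≤ 1190 / 16000 := by
    calc K * y ≤ 1190 * (1 / 16000) := mul_le_mul hK hy1 hy0 (by norm_num)
      _ = 1190 / 16000 := by norm_num
  have hden : (17 : ℝ) / 20 ≤ 1 - 2 * (K * y) := by linarith
  rw [div_le_iff₀ (by linarith)]
  have hc₀0 : 0 ≤ c₀ := by rw [hc₀]; positivity
  -- `c₀ a + 9 K y ≤ (120 a + 26000 y) (17/20) ≤ (120 a + 26000 y)(1 - 2 K y)`
  have h1 : c₀ * a + 9 * (K * y) ≤ (120 * a + 26000 * y) * (17 / 20) := by nlinarith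
  have h2 : (120 * a + 26000 * y) * (17 / 20) ≤ (120 * a + 26000 * y) * (1 - 2 * (K * y)) :=
    mul_le_mul_of_nonneg_left hden (by positivity)
  linarith

/-! ### The insertion bound at range `2` -/

/-- **Insertion bound for potentials of range `2`.** For measurable `v` with `v(r) = 0` for
`r > 2`, `n` particles in the box `L` with `8n ≤ L³/2000`:
`E₀(n+1, L) ≤ E₀(n, L) + 120/L² + 13000 · n · 2/L³`. Proof: dress the inserted particle (the
flat-top orbital of `BoseGasFlatTopProfile`/`BoseGasProductOrbital`, kinetic energy
`≤ 48π²/(11L²)`, density `≤ (16/11)³/L³`) with the product Jastrow factor `∏ⱼ f(x₀ - xⱼ)` of the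
exponential profile (`stub_productJastrow`; it kills the whole interaction of the new particle),
take a near-minimiser `Φ` of `E₀(n, L)` with first-variation error `≤ 1/L²`
(`stub_firstVariation`, `InsertionAssembly.exists_delta_small`), bound the energy of the dressed
product by `InsertionAssembly.dressed_insertion_at` and the Dirichlet bosonic floor, the Jastrow
terms by `sup|Θ|² · n · ∫(1-f)` (`InsertionAssembly.lintegral_W₁`, `lintegral_one_sub_prof_le`),
and cancel the mass (`InsertionScaling.final_bound_real`, `numeric_bound`). Insertion with a
Jastrow factor vanishing on the core is Dyson's device (LSSY2005, Thm 2.2 / (2.17)–(2.26)).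
[folklore] -/
theorem insertionBound_range_two (v : ℝ → ℝ≥0∞) (hv : Measurable v)
    (hv2 : ∀ r, 2 < r → v r = 0) (n : ℕ) (L : ℝ) (hL : 0 < L)
    (hnL : (n : ℝ) * 2 ^ 3 ≤ L ^ 3 / 2000) :
    groundStateEnergy v (n + 1) L ≤
      groundStateEnergy v n L + ENNReal.ofReal (120 / L ^ 2 + 13000 * n * 2 / L ^ 3) := by
  -- nothing to prove if `E₀(n, L) = ∞`
  rcases eq_or_ne (groundStateEnergy v n L) ⊤ with htop | htop
  · rw [htop, top_add]; exact le_top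
  -- the Jastrow profile and the product Jastrow factor
  obtain ⟨hfC, hf01, hfR, hfD⟩ := prof_props
  set f : Space → ℝ := fun z : Space => 1 - (1 + max (‖z‖ - 2) 0) * Real.exp (-max (‖z‖ - 2) 0)
    with hfdef
  obtain ⟨hFC, hFX⟩ := stub_productJastrow f hfC hf01 hfD n
  set F : Config (n + 1) → ℝ := fun X => ∏ j : Fin n, f (X 0 - X j.succ) with hFdef
  have hF01 : ∀ X, 0 ≤ F X ∧ F X ≤ 1 := fun X => (hFX X).1
  have hF0 : ∀ (X : Config (n + 1)) (w : Space),
      ‖fderiv ℝ F X (Pi.single 0 w)‖ ≤ (1 - F X) * ‖w‖ := fun X w => (hFX X).2.1 w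
  have hFj : ∀ (X : Config (n + 1)) (j : Fin n) (w : Space),
      ‖fderiv ℝ F X (Pi.single j.succ w)‖ ≤ (1 - f (X 0 - X j.succ)) * ‖w‖ :=
    fun X j w => (hFX X).2.2.1 j w
  have hFsum : ∀ X : Config (n + 1), 1 - F X ≤ ∑ j : Fin n, (1 - f (X 0 - X j.succ)) :=
    fun X => (hFX X).2.2.2
  have hFd : Differentiable ℝ F := hFC.differentiable one_ne_zero
  have hG5 := fun (x : Space) (Z : Config n) (j : Fin n) (k : Fin 3) =>
    InsertionAssembly.sq_fderiv_sliceFactor_single_le hFd (fun z => (hf01 z).1) hFj x Z j k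
  have hcross : ∀ (x : Space) (Z : Config n) (j : Fin n),
      v (dist x (Z j)) = 0 ∨ F (Matrix.vecCons x Z) = 0 := fun x Z j =>
    cross_or_factor_eq_zero hv2 hfR x Z j
  -- the slack and the near-minimiser
  have hκ : (0 : ℝ) < 1 / L ^ 2 := by positivity
  obtain ⟨d, hd, hsqrt⟩ := InsertionAssembly.exists_delta_small
    (E := (groundStateEnergy v n L).toReal) ENNReal.toReal_nonneg n hκ
  have hlt : groundStateEnergy v n L < groundStateEnergy v n L + ENNReal.ofReal d :=
    ENNReal.lt_add_right htop (ENNReal.ofReal_pos.2 hd).ne'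
  obtain ⟨Φ, hΦ⟩ := iInf_lt_iff.mp hlt
  -- the first variation at every frozen position of the inserted particle (`D = n`)
  have hJ3x : ∀ x : Space,
      ∫⁻ Z, (kineticDensity (fun Z : Config n => (F (Matrix.vecCons x Z) : ℂ) * Φ.ψ Z) Z +
        interaction v Z * (‖(F (Matrix.vecCons x Z) : ℂ) * Φ.ψ Z‖₊ : ℝ≥0∞) ^ 2) ≤
      groundStateEnergy v n L *
          (∫⁻ Z, ENNReal.ofReal (F (Matrix.vecCons x Z) ^ 2) * (‖Φ.ψ Z‖₊ : ℝ≥0∞) ^ 2) +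
        (∫⁻ Z, (∑ j : Fin n, ∑ k : Fin 3, ENNReal.ofReal
          ((fderiv ℝ (fun Z : Config n => F (Matrix.vecCons x Z)) Z
            (Pi.single j (EuclideanSpace.single k (1 : ℝ)))) ^ 2)) * (‖Φ.ψ Z‖₊ : ℝ≥0∞) ^ 2) +
        ENNReal.ofReal (1 / L ^ 2) := by
    intro x
    have h := stub_firstVariation n L v hv Φ (ENNReal.ofReal d) ENNReal.ofReal_ne_top htop hΦ.le
      (fun Z : Config n => F (Matrix.vecCons x Z))
      (hFC.comp (InsertionAssembly.contDiff_vecCons_right x))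
      (fun Z => hF01 _) (InsertionAssembly.sliceFactor_symm f x) n
      (InsertionAssembly.norm_fderiv_sliceFactor_le hFd (fun z => (hf01 z).1) hFj x)
    rw [ENNReal.toReal_ofReal hd.le] at h
    exact h.trans (add_le_add le_rfl (ENNReal.ofReal_le_ofReal hsqrt))
  -- the flat-top orbital
  obtain ⟨b, b', hbd, hb'c, hb01, hbsupp, hbm, hbκ, hbi, hbi'⟩ := FlatTop.exists_flatTopProfile
  obtain ⟨Θ, hΘE, hΘsup⟩ := ProductOrbital.exists_productOrbital hbd hb'c hb01 hbsupp
    (by norm_num : (0 : ℝ) < 11 / 16) hbm hbκ hbi hbi' hL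
  -- one dressed insertion
  obtain ⟨hins, hlow, hM1⟩ := InsertionAssembly.dressed_insertion_at hv
    (fun g hg h0 => DirichletFloor.groundStateEnergy_mul_lintegral_le hv hg h0) hfC hf01 hFC hF01
    hF0 hFsum Φ Θ (z := 0) (fun x hx => by simpa using hx) hcross hG5 hJ3x
  -- the Jastrow weight: `w ≤ sup|Θ|² · n · ∫(1 - f)`
  have hw : (∫⁻ x, (‖Θ.ψ (fun _ => x - 0)‖₊ : ℝ≥0∞) ^ 2 *
      ∫⁻ Z : Config n, (∑ j : Fin n, ENNReal.ofReal (1 - f (x - Z j))) *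
        (‖Φ.ψ Z‖₊ : ℝ≥0∞) ^ 2) ≤
      ENNReal.ofReal ((11 / 16 : ℝ)⁻¹ ^ 3 / L ^ 3 * (n * (4 * Real.pi * (92 / 3)))) := by
    have hmW := InsertionAssembly.measurable_W₁ (n := n) hfC.continuous Φ.contDiff.continuous
    calc _ ≤ ∫⁻ x, ENNReal.ofReal ((11 / 16 : ℝ)⁻¹ ^ 3 / L ^ 3) *
          ∫⁻ Z : Config n, (∑ j : Fin n, ENNReal.ofReal (1 - f (x - Z j))) *
            (‖Φ.ψ Z‖₊ : ℝ≥0∞) ^ 2 :=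
          lintegral_mono fun x => mul_le_mul' (hΘsup _) le_rfl
      _ = ENNReal.ofReal ((11 / 16 : ℝ)⁻¹ ^ 3 / L ^ 3) *
          (n * ∫⁻ y : Space, ENNReal.ofReal (1 - f y)) := by
          rw [lintegral_const_mul _ hmW,
            InsertionAssembly.lintegral_W₁ hfC.continuous Φ.contDiff.continuous Φ.norm_eq]
      _ ≤ ENNReal.ofReal ((11 / 16 : ℝ)⁻¹ ^ 3 / L ^ 3) *
          (n * ENNReal.ofReal (4 * Real.pi * (92 / 3))) := by
          gcongr; exact lintegral_one_sub_prof_le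
      _ = _ := by
          rw [← ENNReal.ofReal_natCast n, ← ENNReal.ofReal_mul (Nat.cast_nonneg n),
            ← ENNReal.ofReal_mul (by positivity)]
  -- the kinetic constant: `2𝓔₀[Θ] + err ≤ (2 · 48π²/11 + 1)/L²`
  have hc : 2 * energy 0 Θ + ENNReal.ofReal (1 / L ^ 2) ≤
      ENNReal.ofReal (2 * (3 * Real.pi ^ 2 / (11 / 16) / L ^ 2) + 1 / L ^ 2) := by
    rw [ENNReal.ofReal_add (by positivity) (by positivity), ENNReal.ofReal_mul (by norm_num),
      ENNReal.ofReal_ofNat]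
    gcongr
  -- cancel the mass
  have hw' : (0 : ℝ) ≤ (11 / 16 : ℝ)⁻¹ ^ 3 / L ^ 3 * (n * (4 * Real.pi * (92 / 3))) := by
    positivity
  have h2w : 2 * ((11 / 16 : ℝ)⁻¹ ^ 3 / L ^ 3 * (n * (4 * Real.pi * (92 / 3)))) < 1 := by
    have hπ := Real.pi_lt_d2
    have hL3 : 0 < L ^ 3 := by positivity
    have hy : (n : ℝ) / L ^ 3 ≤ 1 / 16000 := by rw [div_le_iff₀ hL3]; linarith
    have : (11 / 16 : ℝ)⁻¹ ^ 3 / L ^ 3 * (n * (4 * Real.pi * (92 / 3))) =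
        ((11 / 16 : ℝ)⁻¹ ^ 3 * (4 * Real.pi * (92 / 3))) * (n / L ^ 3) := by ring
    rw [this]
    have hK : (11 / 16 : ℝ)⁻¹ ^ 3 * (4 * Real.pi * (92 / 3)) ≤ 1190 := by nlinarith
    have hKy : (11 / 16 : ℝ)⁻¹ ^ 3 * (4 * Real.pi * (92 / 3)) * (n / L ^ 3) ≤
        1190 * (1 / 16000) := mul_le_mul hK hy (by positivity) (by norm_num)
    linarith
  refine (InsertionScaling.final_bound_real hins hlow hM1 hc hw (by positivity) hw' h2w).trans ?_
  gcongr
  exact numeric_bound hL hnL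

end InsertionBound

open InsertionBound in
/-- **Stub `stub_insertionBound` (F3) of the line `registered` of the crux `RigidMomentumBound`.**
Chemical-potential bound for EVERY measurable finite-range `v ≥ 0` (hard cores included): for `N`
particles in the box `L` at density `N R₀³ ≤ L³/2000` (`R₀` the range),
`E₀(N+1, L) ≤ E₀(N, L) + 120/L² + 13000·N·R₀/L³`. Stated as an implication from the
first-variation brick F1 (not used: the proof runs on the tree's first variation
`stub_firstVariation` of the crux `OneBodyEntropyBound`). Proof: by the exact dilation covariance
of `E₀` (`InsertionScaling.insertionBound_of_fixedRange`) it suffices to treat the range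
`R₀ = 2`, which is `insertionBound_range_two` (insertion of one particle in the flat-top
orbital, dressed with the product Jastrow factor of the exponential profile, which kills its
whole interaction; Dyson's device, LSSY2005 Thm 2.2). [folklore] -/
theorem stub_insertionBound :
    (      ∀ (v : ℝ → ℝ≥0∞), Measurable v → ∀ {N : ℕ} {L : ℝ} (Φ : TrialState N L) (G : Config N → ℝ) (D : ℝ),
      ContDiff ℝ 1 G → (∀ X, |G X| ≤ 1) →
      (∀ X, ∑ i : Fin N, ∑ k : Fin 3,
      (fderiv ℝ G X (Pi.single i (EuclideanSpace.single k (1 : ℝ)))) ^ 2 ≤ D ^ 2) →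
      0 ≤ D → energy v Φ ≠ ⊤ → ∀ δ : ℝ, 0 < δ →
      energy v Φ ≤ groundStateEnergy v N L + ENNReal.ofReal δ →
      |(∫ X, G X * (kineticDensity Φ.ψ X + interaction v X * (‖Φ.ψ X‖₊ : ℝ≥0∞) ^ 2).toReal) +
      (∫ X, ∑ i : Fin N, ∑ k : Fin 3,
      fderiv ℝ G X (Pi.single i (EuclideanSpace.single k (1 : ℝ))) *
      RCLike.re (starRingEnd ℂ (Φ.ψ X) *
      fderiv ℝ Φ.ψ X (Pi.single i (EuclideanSpace.single k (1 : ℝ))))) -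
      (energy v Φ).toReal * ∫ X, G X * ‖Φ.ψ X‖ ^ 2|
      ≤ Real.sqrt δ * (3 * (energy v Φ).toReal + 2 * D ^ 2 + δ + 1) + δ) →
    ∀ (v : ℝ → ℝ≥0∞), Measurable v → ∀ R₀ : ℝ, 0 < R₀ → (∀ r, R₀ < r → v r = 0) →
      ∀ (N : ℕ) (L : ℝ), 0 < L → 8 * R₀ ≤ L → (N : ℝ) * R₀ ^ 3 ≤ L ^ 3 / 2000 →
        groundStateEnergy v (N + 1) L ≤
          groundStateEnergy v N L + ENNReal.ofReal (120 / L ^ 2 + 13000 * N * R₀ / L ^ 3) := by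
  intro _ v hv R₀ hR₀ hvR N L hL _ hNL
  exact InsertionScaling.insertionBound_of_fixedRange (c := 2) (A := 120) (B := 13000) two_pos
    (fun v hv hv2 N L hL hNL => insertionBound_range_two v hv hv2 N L hL hNL) hv hR₀ hvR N hL hNL

end Summit.AtomisticToContinuum.BoseEinsteinCondensation.Theorems.RigidMomentumBound

end
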